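import Mathlib
import Summits.NavierStokesRegularity.NavierStokesRegularity.Theorems.EulerZoomLiouvillePowerGaugeEulerLiouvilleSelfSimilarTopBadNodeHyperbolic
import HarnessLib.Audit

/-!
# Rung C1 of the crux `EulerZoomLiouville.PowerGaugeEulerLiouville`: real-variable dynamics lemmas for the
# exit analysis along a stagnation arc (cone invariance, decay regime, `C^{1,1}` graphs)

Route №10 `EulerZoomLiouville` (NavierStokesRegularity), crux E = stmt-NavierStokesRegularity-19832,
tenure rung C1 (exactly self-similar members), registered residue `stub_selfSimilarExtremal`.
Ninth file of the NODAL-CONTINUUM line (lineage ns-typeII-p1, gen 7): the scalar comparison arguments of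
`…SelfSimilarTopBadNodeArc`, isolated as lemmas about real functions `p` (backward-contracting part of
`|ξ|²`), `m` (the rest), `τ` (arc coordinate) along a trajectory, with the differential inequalities
`p' ≤ −μp + c(p+m)`, `m' ≥ μm − c(p+m)`, `|τ'| ≤ ρ|ξ|` valid on `[0, t₁]`:

* `norm_graph_le_sq` — a `C^{1,1}` graph with `g(0) = 0`, `|g'(τ)| ≤ L|τ|` has `|g(τ)| ≤ Lτ²`;
* `cone_invariant_of_ineq` — **cone invariance**: if `K p ≤ m` at some `t_c ∈ [0, t₁]` then `K p ≤ m`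
  at `t₁` (`c(1+K) ≤ μ/16`, `p + m > 0`; barrier for `Kp − m`);
* `decay_regime_bounds` — **decay regime**: if `m < K p` throughout `[0, t₁]` and `c(1+K) ≤ μ/2`, then
  `p ≤ p(0)e^{−μt/2}`, `|ξ| ≤ 3(1+K)ε e^{−μt/4}` and the drift of `τ` is at most `ε`
  (`p(0) ≤ 9ε²`, `|τ(0)| ≤ ε`, `4ρ·3(1+K)ε/μ = ε`): at `t₁`, `|τ| ≤ 2ε` and `|ξ| ≤ 3(1+K)ε`.

WHAT THIS IS NOT: not NS, not E — elementary real analysis (monotonicity and barrier arguments).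
References: A. Katok, B. Hasselblatt (1995), §6.2 (cone criterion) [KatokHasselblatt1995];
P. Constantin, M. Ignatova, V. Vicol, arXiv:2602.17570 (2026), §3.5 [ConstantinIgnatovaVicol2026Putative].
-/

noncomputable section

-- flat `Theorems/<Route><Decl>…` files of one crux share the namespace of the crux (tree convention)
set_option linter.dupNamespace false

open Set Filter Topology Metric Function InnerProductSpace
open scoped RealInnerProductSpace NNReal

namespace Summit.NavierStokesRegularity.NavierStokesRegularity.Theorems.PowerGaugeEulerLiouville.NodalContinuum

/-- A `C^{1,1}` graph with `g(0) = 0`, `|g'(τ)| ≤ L|τ|` (`L ≥ 0`) satisfies `|g(τ)| ≤ Lτ²` (mean value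
inequality on `[−|τ|, |τ|]`). [folklore] -/
theorem norm_graph_le_sq {g g' : ℝ → EuclideanSpace ℝ (Fin 3)} {δ L : ℝ} (hL : 0 ≤ L)
    (hg0 : g 0 = 0) (hgd : ∀ τ, HasDerivAt g (g' τ) τ) (hg' : ∀ τ, |τ| ≤ δ → ‖g' τ‖ ≤ L * |τ|)
    {τ : ℝ} (hτ : |τ| ≤ δ) : ‖g τ‖ ≤ L * τ ^ 2 := by
  set s : Set ℝ := Icc (-|τ|) |τ| with hs
  have hmem : ∀ x ∈ s, |x| ≤ |τ| := fun x hx => abs_le.2 ⟨hx.1, hx.2⟩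
  have h1 := (convex_Icc (-|τ|) |τ|).norm_image_sub_le_of_norm_hasDerivWithin_le
    (f := g) (f' := g') (C := L * |τ|) (fun x _ => (hgd x).hasDerivWithinAt)
    (fun x hx => (hg' x ((hmem x hx).trans hτ)).trans (mul_le_mul_of_nonneg_left (hmem x hx) hL))
    (show (0 : ℝ) ∈ s from ⟨by simp, by simp⟩) (show τ ∈ s from ⟨neg_abs_le τ, le_abs_self τ⟩)
  rw [hg0, sub_zero, sub_zero, Real.norm_eq_abs] at h1
  calc ‖g τ‖ ≤ L * |τ| * |τ| := h1
    _ = L * τ ^ 2 := by rw [mul_assoc, ← sq, sq_abs]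

/-- **Cone invariance.**  Real functions `p, m` with `p + m > 0` on `[0, t₁]`, derivatives `pd, md`
with `pd ≤ −μp + c(p+m)` and `md ≥ μm − c(p+m)` there (`μ > 0`, `c(1+K) ≤ μ/16`, `K ≥ 1`): if
`K p ≤ m` at some `t_c ∈ [0, t₁]`, then `K p ≤ m` at `t₁` (on the boundary `m = Kp` of the cone,
`(Kp − m)' ≤ −2Kμp + (1+K)·(μ/16)p < 0`). [cite: KatokHasselblatt1995, §6.2 (cone criterion)] -/
theorem cone_invariant_of_ineq {p m pd md : ℝ → ℝ} {K μ c tc t₁ : ℝ} (hK1 : 1 ≤ K) (hμ : 0 < μ)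
    (hcK : c * (1 + K) ≤ μ / 16)
    (hp' : ∀ t, HasDerivAt p (pd t) t) (hm' : ∀ t, HasDerivAt m (md t) t)
    (hpos : ∀ t ∈ Icc 0 t₁, 0 < p t + m t)
    (hpd : ∀ t ∈ Icc 0 t₁, pd t ≤ -μ * p t + c * (p t + m t))
    (hmd : ∀ t ∈ Icc 0 t₁, μ * m t - c * (p t + m t) ≤ md t)
    (htc : tc ∈ Icc 0 t₁) (hcone0 : K * p tc ≤ m tc) : K * p t₁ ≤ m t₁ := by
  have hKpos : 0 < K := by linarith
  have hsub : Icc tc t₁ ⊆ Icc 0 t₁ := Icc_subset_Icc htc.1 le_rfl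
  have key := image_le_of_deriv_right_lt_deriv_boundary' (f := fun t => K * p t - m t)
    (f' := fun t => K * pd t - md t) (a := tc) (b := t₁)
    (fun s _ => (((hp' s).const_mul K).sub (hm' s)).continuousAt.continuousWithinAt)
    (fun s _ => (((hp' s).const_mul K).sub (hm' s)).hasDerivWithinAt)
    (B := fun _ => 0) (B' := fun _ => 0) (by linarith only [hcone0]) continuousOn_const
    (fun s _ => hasDerivWithinAt_const _ _ _) ?_ (right_mem_Icc.2 htc.2)
  · linarith only [key]
  intro s hs hfs
  have hs' : s ∈ Icc 0 t₁ := hsub ⟨hs.1, hs.2.le⟩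
  have hms : m s = K * p s := by linarith only [hfs]
  have hps : 0 < p s := by
    have := hpos s hs'
    rw [hms] at this
    nlinarith only [this, hKpos]
  have h1 := hpd s hs'
  have h2 := hmd s hs'
  rw [hms] at h1 h2
  have h3 : c * (p s + K * p s) ≤ μ / 16 * p s := by
    have := mul_le_mul_of_nonneg_right hcK hps.le
    linarith only [this]
  have h1K := mul_le_mul_of_nonneg_left h1 hKpos.le
  have h3K := mul_le_mul_of_nonneg_left h3 hKpos.le
  have h6 : 0 < μ * p s * (31 * K - 1) := mul_pos (mul_pos hμ hps) (by linarith only [hK1])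
  show K * pd s - md s < 0
  nlinarith only [h1K, h2, h3, h3K, h6]

/-- **Decay regime.**  With `p, m, τ` as above and a vector function `ξ` with `p + m = |ξ|²`: if
`m < Kp` throughout `[0, t₁]` (`t₁ > 0`), `pd ≤ −μp + c(p+m)` with `c(1+K) ≤ μ/2`, `|τ'| ≤ ρ|ξ|`,
`p(0) ≤ 9ε²`, `|τ(0)| ≤ ε` and `4ρ·(3(1+K)ε)/μ = ε`, then at `t₁`: `|τ| ≤ 2ε` and `|ξ| ≤ 3(1+K)ε`
(`e^{μt/2}p` is nonincreasing; `|ξ| ≤ 3(1+K)ε e^{−μt/4}`; `±τ + (4ρS/μ)e^{−μt/4}` is nonincreasing).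
[folklore] -/
theorem decay_regime_bounds {p m τ pd τd : ℝ → ℝ} {ξ : ℝ → EuclideanSpace ℝ (Fin 3)}
    {K μ c ρ ε t₁ : ℝ} (hK1 : 1 ≤ K) (hμ : 0 < μ) (hc0 : 0 ≤ c) (hcK : c * (1 + K) ≤ μ / 2)
    (hρ : 0 < ρ) (hε : 0 < ε) (hρS : 4 * ρ * (3 * (1 + K) * ε) / μ = ε) (ht₁ : 0 < t₁)
    (hp' : ∀ t, HasDerivAt p (pd t) t) (hτ' : ∀ t, HasDerivAt τ (τd t) t)
    (hpm : ∀ t, p t + m t = ‖ξ t‖ ^ 2) (hpnn : ∀ t, 0 ≤ p t)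
    (hcone : ∀ t ∈ Icc 0 t₁, m t < K * p t)
    (hpd : ∀ t ∈ Icc 0 t₁, pd t ≤ -μ * p t + c * (p t + m t))
    (hτd : ∀ t ∈ Icc 0 t₁, |τd t| ≤ ρ * ‖ξ t‖)
    (hp0 : p 0 ≤ 9 * ε ^ 2) (hτ0 : |τ 0| ≤ ε) :
    |τ t₁| ≤ 2 * ε ∧ ‖ξ t₁‖ ≤ 3 * (1 + K) * ε := by
  set S : ℝ := 3 * (1 + K) * ε with hS
  have hSpos : 0 < S := by positivity
  have hpdec : ∀ t ∈ Icc 0 t₁, pd t ≤ -(μ / 2) * p t := by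
    intro t ht
    have h1 := hpd t ht
    have h2 : p t + m t ≤ (1 + K) * p t := by linarith only [hcone t ht]
    have h3 : c * (p t + m t) ≤ μ / 2 * p t := by
      have := mul_le_mul_of_nonneg_left h2 hc0
      have := mul_le_mul_of_nonneg_right hcK (hpnn t)
      nlinarith only [mul_le_mul_of_nonneg_left h2 hc0, mul_le_mul_of_nonneg_right hcK (hpnn t)]
    linarith only [h1, h3]
  -- `e^{μ t/2} p` is nonincreasing on `[0, t₁]`
  set G : ℝ → ℝ := fun t => Real.exp (μ / 2 * t) * p t with hGdef
  have hG' : ∀ t, HasDerivAt G (Real.exp (μ / 2 * t) * (μ / 2 * p t + pd t)) t := by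
    intro t
    have he' : HasDerivAt (fun t => Real.exp (μ / 2 * t)) (Real.exp (μ / 2 * t) * (μ / 2 * 1)) t :=
      ((hasDerivAt_id t).const_mul (μ / 2)).exp
    exact (he'.mul (hp' t)).congr_deriv (by ring)
  have hGanti : AntitoneOn G (Icc 0 t₁) := by
    refine antitoneOn_of_hasDerivWithinAt_nonpos (convex_Icc 0 t₁)
      (fun s _ => (hG' s).continuousAt.continuousWithinAt)
      (fun s _ => (hG' s).hasDerivWithinAt) ?_
    intro s hs
    rw [interior_Icc] at hs
    have := hpdec s ⟨hs.1.le, hs.2.le⟩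
    exact mul_nonpos_iff.2 (Or.inl ⟨(Real.exp_pos _).le, by linarith only [this]⟩)
  -- `‖ξ t‖ ≤ S e^{-μ t/4}` on `[0, t₁]`
  have hξdec : ∀ t ∈ Icc 0 t₁, ‖ξ t‖ ≤ S * Real.exp (-(μ / 4) * t) := by
    intro t ht
    have h1 : G t ≤ G 0 := hGanti (left_mem_Icc.2 ht₁.le) ht ht.1
    simp only [hGdef, mul_zero, Real.exp_zero, one_mul] at h1
    have h2 : ‖ξ t‖ ^ 2 ≤ (1 + K) * p t := by rw [← hpm t]; linarith only [hcone t ht]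
    have hexp2 : Real.exp (μ / 2 * t) = (Real.exp (μ / 4 * t)) ^ 2 := by
      rw [← Real.exp_nat_mul]; ring_nf
    have hexpn : Real.exp (-(μ / 4) * t) * Real.exp (μ / 4 * t) = 1 := by
      rw [← Real.exp_add]; simp
    have h3 : (‖ξ t‖ * Real.exp (μ / 4 * t)) ^ 2 ≤ S ^ 2 := by
      have h4 := mul_le_mul_of_nonneg_right h2 (Real.exp_pos (μ / 2 * t)).le
      have h5 : (1 + K) * (Real.exp (μ / 2 * t) * p t) ≤ (1 + K) * (9 * ε ^ 2) :=
        mul_le_mul_of_nonneg_left (h1.trans hp0) (by linarith only [hK1])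
      calc (‖ξ t‖ * Real.exp (μ / 4 * t)) ^ 2 = ‖ξ t‖ ^ 2 * Real.exp (μ / 2 * t) := by
            rw [hexp2]; ring
        _ ≤ (1 + K) * (9 * ε ^ 2) := by linarith only [h4, h5]
        _ ≤ S ^ 2 := by rw [hS]; nlinarith only [hK1, hε]
    have h4 : ‖ξ t‖ * Real.exp (μ / 4 * t) ≤ S :=
      (pow_le_pow_iff_left₀ (by positivity) hSpos.le two_ne_zero).1 h3
    calc ‖ξ t‖ = ‖ξ t‖ * Real.exp (μ / 4 * t) * Real.exp (-(μ / 4) * t) := by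
          rw [mul_assoc, mul_comm (Real.exp _), hexpn, mul_one]
      _ ≤ S * Real.exp (-(μ / 4) * t) := mul_le_mul_of_nonneg_right h4 (Real.exp_pos _).le
  -- drift of `τ`
  have hdrift : ∀ σ : ℝ, |σ| = 1 → σ * τ t₁ ≤ σ * τ 0 + ε := by
    intro σ hσ1
    set ψ : ℝ → ℝ := fun t => σ * τ t + 4 * ρ * S / μ * Real.exp (-(μ / 4) * t) with hψ
    have hψ' : ∀ t, HasDerivAt ψ (σ * τd t + 4 * ρ * S / μ * (Real.exp (-(μ / 4) * t) *
        (-(μ / 4) * 1))) t := fun t =>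
      ((hτ' t).const_mul σ).add ((((hasDerivAt_id t).const_mul (-(μ / 4))).exp).const_mul _)
    have hψanti : AntitoneOn ψ (Icc 0 t₁) := by
      refine antitoneOn_of_hasDerivWithinAt_nonpos (convex_Icc 0 t₁)
        (fun s _ => (hψ' s).continuousAt.continuousWithinAt)
        (fun s _ => (hψ' s).hasDerivWithinAt) ?_
      intro s hs
      rw [interior_Icc] at hs
      have hs' : s ∈ Icc 0 t₁ := ⟨hs.1.le, hs.2.le⟩
      have h1 : σ * τd s ≤ ρ * ‖ξ s‖ := by
        have h0 := hτd s hs'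
        have h2 : |σ * τd s| = |τd s| := by rw [abs_mul, hσ1, one_mul]
        linarith only [h0, h2, le_abs_self (σ * τd s)]
      have h3 : ρ * ‖ξ s‖ ≤ ρ * (S * Real.exp (-(μ / 4) * s)) :=
        mul_le_mul_of_nonneg_left (hξdec s hs') hρ.le
      have h4 : 4 * ρ * S / μ * (Real.exp (-(μ / 4) * s) * (-(μ / 4) * 1)) =
          -(ρ * (S * Real.exp (-(μ / 4) * s))) := by field_simp
      rw [h4]; linarith only [h1, h3]
    have h1 := hψanti (left_mem_Icc.2 ht₁.le) (right_mem_Icc.2 ht₁.le) ht₁.le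
    simp only [hψ, mul_zero, Real.exp_zero, mul_one] at h1
    have h2 : 0 ≤ 4 * ρ * S / μ * Real.exp (-(μ / 4) * t₁) := by positivity
    have h3 : 4 * ρ * S / μ = ε := by rw [hS]; exact hρS
    linarith only [h1, h2, h3]
  refine ⟨?_, ?_⟩
  · have h1 := hdrift 1 (by simp)
    have h2 := hdrift (-1) (by simp)
    rw [abs_le]; rw [abs_le] at hτ0
    constructor <;> linarith only [h1, h2, hτ0.1, hτ0.2]
  · have h1 := hξdec t₁ (right_mem_Icc.2 ht₁.le)
    have h2 : Real.exp (-(μ / 4) * t₁) ≤ 1 := by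
      rw [Real.exp_le_one_iff]; nlinarith only [hμ, ht₁]
    exact h1.trans (mul_le_of_le_one_right hSpos.le h2)

end Summit.NavierStokesRegularity.NavierStokesRegularity.Theorems.PowerGaugeEulerLiouville.NodalContinuum
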